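import Literature.NumberTheory.EllipticCurves.RootNumberTableTwo
import Literature.NumberTheory.Sieve.GoldbachLinnikRomanovConstBound
import HarnessLib

/-!
# BSD rank ≥ 2 observatory (`b2b-bsdr2`): kernel arithmetic for root-number certificates

HONEST FRAMING: per-curve certified theorems and census instruments; no claim on BSD in rank ≥ 2.

Kernel-reducible replacements (structural recursion with explicit fuel, no well-founded recursion)
for the arithmetic the root-number certificates of `Rank2ObservatoryRootNumberCert` need, each with
its correctness lemma: `binPowMod b e m = b ^ e % m` (BINARY exponentiation, `O(log e)` kernel steps —
the exponents here are `(p − 1)/2` with `p` up to `5·10⁵`; primality by trial division is the landed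
`GoldbachLinnik.primeCert`); `exactPow p k x` ⇔ `pᵏ ∥ x` (hence `padicValInt`); Euler's criterion
read off `binPowMod`; and the corrected `ℚ₂` table value of Kellock–Dokchitser
(`KellockDokchitser.w2OfInvariants'`, `RootNumberTableTwo`) at INTEGER invariants as the
kernel-computable `w2OfInt` (`v₂`, odd parts mod `64`, from `2ᵏ ∥ x`; Notation 5.1 of
Kellock–Dokchitser 2023). References: [KellockDokchitser2023] Notation 5.1, §5.
-/

set_option linter.dupNamespace false
set_option autoImplicit false

open Literature.NumberTheory.EllipticCurves

namespace Summit.BirchSwinnertonDyer.BirchSwinnertonDyer.Rank2Observatory.RootNumber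

/-! ### Kernel arithmetic: binary modular powers, exact prime powers

Primality by trial division is the landed `Literature.NumberTheory.Sieve.GoldbachLinnik.primeCert`
(`prime_of_primeCert`), reused by the certificates. -/

/-- Square-and-multiply modular power with fuel: `binPowModAux m fuel b e acc = acc · bᵉ mod m` when
`e < 2^fuel`. [folklore] -/
def binPowModAux (m : ℕ) : ℕ → ℕ → ℕ → ℕ → ℕ
  | 0, _, _, acc => acc % m
  | fuel + 1, b, e, acc =>
    if e = 0 then acc % m
    else binPowModAux m fuel (b * b % m) (e / 2) (if e % 2 = 1 then acc * b % m else acc)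

/-- `binPowMod b e m = bᵉ mod m`. [folklore] -/
def binPowMod (b e m : ℕ) : ℕ := binPowModAux m (e + 1) b e 1

/-- Correctness of `binPowModAux`. [folklore] -/
theorem binPowModAux_spec (m : ℕ) :
    ∀ fuel b e acc, e < 2 ^ fuel → binPowModAux m fuel b e acc = acc * b ^ e % m
  | 0, b, e, acc, he => by
    have : e = 0 := by simpa using he
    subst this
    simp [binPowModAux]
  | fuel + 1, b, e, acc, he => by
    by_cases h0 : e = 0
    · subst h0; simp [binPowModAux]
    rw [binPowModAux, if_neg h0, binPowModAux_spec m fuel _ _ _ (by rw [pow_succ] at he; omega)]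
    have hb : (b * b % m) ^ (e / 2) ≡ (b * b) ^ (e / 2) [MOD m] := (Nat.mod_modEq _ _).pow _
    have he2 : b ^ e = b ^ (e % 2) * (b * b) ^ (e / 2) := by
      rw [← pow_two, ← pow_mul, ← pow_add]
      congr 1
      omega
    change _ ≡ _ [MOD m]
    rw [he2, ← mul_assoc]
    refine Nat.ModEq.mul ?_ hb
    split_ifs with h1
    · rw [h1, pow_one]
      exact Nat.mod_modEq _ _
    · have h0' : e % 2 = 0 := by omega
      rw [h0', pow_zero, mul_one]

/-- Correctness of `binPowMod`. [folklore] -/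
theorem binPowMod_eq (b e m : ℕ) : binPowMod b e m = b ^ e % m := by
  rw [binPowMod, binPowModAux_spec m (e + 1) b e 1
    (lt_of_lt_of_le Nat.lt_two_pow_self (Nat.pow_le_pow_right two_pos e.le_succ)), one_mul]

/-- `exactPow p k x`: `pᵏ ∣ x` and `pᵏ⁺¹ ∤ x` (`pᵏ ∥ x`, so `x ≠ 0`). [folklore] -/
def exactPow (p k : ℕ) (x : ℤ) : Bool :=
  decide ((p : ℤ) ^ k ∣ x ∧ ¬ (p : ℤ) ^ (k + 1) ∣ x)

/-- `pᵏ ∥ x` forces `x ≠ 0`. [folklore] -/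
theorem ne_zero_of_exactPow {p k : ℕ} {x : ℤ} (h : exactPow p k x = true) : x ≠ 0 := by
  simp only [exactPow, decide_eq_true_eq] at h
  rintro rfl
  exact h.2 (dvd_zero _)

/-- The divisibility half of `exactPow`. [folklore] -/
theorem dvd_of_exactPow {p k : ℕ} {x : ℤ} (h : exactPow p k x = true) : (p : ℤ) ^ k ∣ x := by
  simp only [exactPow, decide_eq_true_eq] at h
  exact h.1

/-- `exactPow p k x` says `pᵏ ∥ x`. [folklore] -/
theorem exactPow_spec {p k : ℕ} {x : ℤ} (h : exactPow p k x = true) :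
    (p : ℤ) ^ k ∣ x ∧ ¬ (p : ℤ) ^ (k + 1) ∣ x := by
  simpa only [exactPow, decide_eq_true_eq] using h

/-- `pᵏ ∥ x` gives `ord_p x = k`. [folklore] -/
theorem padicValInt_of_exactPow {p k : ℕ} [Fact p.Prime] {x : ℤ} (h : exactPow p k x = true) :
    padicValInt p x = k := by
  have hx := ne_zero_of_exactPow h
  simp only [exactPow, decide_eq_true_eq] at h
  have h1 : k ≤ padicValInt p x := ((padicValInt_dvd_iff k x).mp h.1).resolve_left hx
  have h2 : ¬ k + 1 ≤ padicValInt p x :=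
    fun h' ↦ h.2 ((padicValInt_dvd_iff (k + 1) x).mpr (Or.inr h'))
  omega

/-! ### The corrected `ℚ₂` table at integer invariants -/

/-- `v₂` in `WithTop ℤ` of an integer `x` with `2ᵏ ∥ x` (`⊤ ` for `x = 0`): the integer form of
`KellockDokchitser.val2`. [cite: KellockDokchitser2023, Notation 5.1] -/
def val2Int (x : ℤ) (k : ℕ) : WithTop ℤ :=
  if x = 0 then ⊤ else ((k : ℤ) : WithTop ℤ)

/-- The odd part of an integer `x` with `2ᵏ ∥ x`, modulo `64` (in `{0, …, 63}`; `0` for `x = 0`): the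
integer form of `KellockDokchitser.oddRes`. [cite: KellockDokchitser2023, Notation 5.1] -/
def oddResInt (x : ℤ) (k : ℕ) : ℤ :=
  (x / 2 ^ k) % 64

/-- The corrected Kellock–Dokchitser `ℚ₂` table value from INTEGER invariants `c₄, c₆, Δ` and their
`2`-adic valuations `k₄, k₆, k_Δ` (Notation 5.1: shift `m`, reduced exponents, odd residues; then
`w2Table'`): a kernel-computable mirror of `KellockDokchitser.w2OfInvariants'`.
[cite: KellockDokchitser2023, Notation 5.1 and §5 Table, rows (0,5,2) corrected] -/
def w2OfInt (c₄ c₆ Δ : ℤ) (k₄ k₆ kΔ : ℕ) : ℤ :=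
  let m : ℤ := KellockDokchitser.shift ((kΔ : ℕ) : ℤ) (val2Int c₆ k₆) (val2Int c₄ k₄)
  KellockDokchitser.w2Table' (((kΔ : ℕ) : ℤ) - 12 * m) ((val2Int c₆ k₆).map fun n => n - 6 * m)
    ((val2Int c₄ k₄).map fun n => n - 4 * m) (oddResInt c₄ k₄) (oddResInt c₆ k₆) (oddResInt Δ kΔ)

/-- `padicValRat 2` of a cast integer with `2ᵏ ∥ x` is `k`. [folklore] -/
theorem padicValRat_intCast_of_exactPow {k : ℕ} {x : ℤ} (h : exactPow 2 k x = true) :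
    padicValRat 2 (x : ℚ) = k := by
  haveI : Fact (2 : ℕ).Prime := ⟨Nat.prime_two⟩
  rw [padicValRat.of_int, padicValInt_of_exactPow h]

/-- `KellockDokchitser.val2` at a cast integer. [cite: KellockDokchitser2023, Notation 5.1] -/
theorem val2_intCast {k : ℕ} {x : ℤ} (h : x = 0 ∨ exactPow 2 k x = true) :
    KellockDokchitser.val2 (x : ℚ) = val2Int x k := by
  unfold KellockDokchitser.val2 val2Int
  rcases eq_or_ne x 0 with h0 | h0
  · subst h0; simp
  · rw [if_neg (by exact_mod_cast h0), if_neg h0, padicValRat_intCast_of_exactPow (h.resolve_left h0)]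

/-- `KellockDokchitser.oddRes` at a cast integer. [cite: KellockDokchitser2023, Notation 5.1] -/
theorem oddRes_intCast {k : ℕ} {x : ℤ} (h : x = 0 ∨ exactPow 2 k x = true) :
    KellockDokchitser.oddRes (x : ℚ) = oddResInt x k := by
  unfold KellockDokchitser.oddRes KellockDokchitser.oddPart oddResInt
  rcases eq_or_ne x 0 with h0 | h0
  · subst h0; simp
  · have hk := padicValRat_intCast_of_exactPow (h.resolve_left h0)
    have hdvd : ((2 ^ k : ℤ) : ℤ) ∣ x := dvd_of_exactPow (h.resolve_left h0)
    have hq : (x : ℚ) / 2 ^ padicValRat 2 (x : ℚ) = ((x / 2 ^ k : ℤ) : ℚ) := by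
      rw [hk, zpow_natCast, Int.cast_div hdvd (by positivity)]
      push_cast
      rfl
    simp only [hq, Rat.den_intCast, ↓reduceIte, Rat.num_intCast]

/-- **The corrected `ℚ₂` table at integer invariants**: for integers `c₄, c₆, Δ` with `2^{k_Δ} ∥ Δ`
and `2^{k₄} ∥ c₄` (or `c₄ = 0`), `2^{k₆} ∥ c₆` (or `c₆ = 0`),
`w2OfInvariants' c₄ c₆ Δ = w2OfInt c₄ c₆ Δ k₄ k₆ k_Δ`.
[cite: KellockDokchitser2023, Notation 5.1 and §5 Table, rows (0,5,2) corrected] -/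
theorem w2OfInvariants'_intCast (c₄ c₆ Δ : ℤ) (k₄ k₆ kΔ : ℕ) (h₄ : c₄ = 0 ∨ exactPow 2 k₄ c₄ = true)
    (h₆ : c₆ = 0 ∨ exactPow 2 k₆ c₆ = true) (hΔ : exactPow 2 kΔ Δ = true) :
    KellockDokchitser.w2OfInvariants' (c₄ : ℚ) (c₆ : ℚ) (Δ : ℚ) = w2OfInt c₄ c₆ Δ k₄ k₆ kΔ := by
  unfold KellockDokchitser.w2OfInvariants' w2OfInt
  simp only [padicValRat_intCast_of_exactPow hΔ, val2_intCast h₄, val2_intCast h₆, oddRes_intCast h₄,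
    oddRes_intCast h₆, oddRes_intCast (Or.inr hΔ)]

/-- Euler's criterion read off `binPowMod`: `d^{(p−1)/2} ≡ p − 1` gives `d^{(p−1)/2} = −1` in `ℤ/p`.
[folklore] -/
theorem pow_eq_neg_one_of_binPowMod {p : ℕ} (hp : p.Prime) {d : ℤ}
    (h : binPowMod ((d % (p : ℤ)).toNat) (p / 2) p = p - 1) : (d : ZMod p) ^ (p / 2) = -1 := by
  haveI : NeZero p := ⟨hp.ne_zero⟩
  rw [binPowMod_eq] at h
  have hcast := congrArg (Nat.cast : ℕ → ZMod p) h
  rw [ZMod.natCast_mod, Nat.cast_pow, Nat.cast_sub hp.one_le, Nat.cast_one, ZMod.natCast_self,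
    zero_sub] at hcast
  have hd : (((d % (p : ℤ)).toNat : ℕ) : ZMod p) = (d : ZMod p) := by
    have h0 : 0 ≤ d % (p : ℤ) := Int.emod_nonneg _ (by exact_mod_cast hp.ne_zero)
    rw [← ZMod.intCast_mod d p, ← Int.toNat_of_nonneg h0, Int.cast_natCast, Int.toNat_of_nonneg h0]
  rwa [hd] at hcast

end Summit.BirchSwinnertonDyer.BirchSwinnertonDyer.Rank2Observatory.RootNumber
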